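import Summits.AtomisticToContinuum.BoseEinsteinCondensation.Theorems.BECThomsonPrincipleGDTransferBareAdmissibleSlot

/-!
# Route `BECThomsonPrinciple`, crux `GDTransfer` (stmt-AtomisticToContinuum-9482), line `dyson-dressed-witness`:
# stub `bareAdmissible`, part 2 — `[∇_j, P_i] = 0`: kinetic energy and energy form of `P_i h` and of `e_p(x_a)h`

Support file of `stub_bareAdmissible`, continuing part 1 (`…BareAdmissibleSlot`).  One derivative under the
integral over the bounded cell (`fderiv_parametric_setIntegral_apply` of `Literature.Analysis.FunctionSpaces`)
gives `D(P_i g)(X)V = P_i(Dg(·)(V; V_i ↦ 0))(X)` (`fderiv_cellAvg_apply`): the cell average commutes with the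
derivatives in the other slots and kills the derivative in slot `i`.  With Jensen on the cell and Fubini in
slot `i` (part 1): `|∇P_i g|²(X) ≤ L⁻³∫_cell |∇g|²(X; x_i ↦ y) dy` and `∫|∇ P_i g|² ≤ ∫|∇g|²`, whence the energy
form bound `𝓔(P_i g) ≤ 𝓔(g) + N² L⁻³‖v‖₁ ‖g‖²` (`eform_cellAvg_le`).  For the plane-wave factor of the LNSS
creator, `∇_a(e_p(x_a) f) = e_p(x_a)(∇_a f + i k f)`, `k = 2πp/L` (`fderiv_cellWave_apply_single`), so
`𝓔(e_p(x_a)f) ≤ 2𝓔(f) + 6N(2π‖p‖/L)²‖f‖²` and `‖e_p(x_a)f‖ = ‖f‖` (`eform_phase_mul_le`, `mass_phase_mul`).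
All [folklore] (LSSY2005 App. A; arXiv:1211.2778 §2).
-/

noncomputable section

open MeasureTheory Filter
open scoped ENNReal NNReal ComplexConjugate

namespace Summit.AtomisticToContinuum.BoseEinsteinCondensation.Cruxes.GDTransfer.DysonDressedWitness

namespace Bare

open Literature.MathematicalPhysics.QuantumManyBody.BoseGas
open Summit.AtomisticToContinuum.BoseEinsteinCondensation.Theorems.GaussianDominationCan.Negative

variable {N n : ℕ} {L : ℝ}

/-! ## The derivative of the cell average -/

/-- The substitution `(y, X) ↦ X[i ↦ y]` is a continuous linear map. [folklore] -/
theorem exists_clm_update (i : Fin N) :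
    ∃ U : Space × Config N →L[ℝ] Config N, ∀ q, U q = Function.update q.2 i q.1 := by
  classical
  refine ⟨ContinuousLinearMap.pi fun j => if j = i then ContinuousLinearMap.fst ℝ Space (Config N)
    else (ContinuousLinearMap.proj j).comp (ContinuousLinearMap.snd ℝ Space (Config N)), fun q => ?_⟩
  funext j
  by_cases hj : j = i
  · subst hj; simp
  · simp [hj]

/-- **`[∇, P_i]`**: `D(P_i g)(X) V = P_i (Y ↦ Dg(Y)(V; V_i ↦ 0)) (X)` for `C¹` `g` (one derivative under
the integral over the bounded cell). [folklore] -/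
theorem fderiv_cellAvg_apply (i : Fin N) {g : Config N → ℂ} (hg : ContDiff ℝ 1 g) (X V : Config N) :
    fderiv ℝ (cellAvg N L i g) X V =
      cellAvg N L i (fun Y => fderiv ℝ g Y (Function.update V i 0)) X := by
  obtain ⟨U, hU⟩ := exists_clm_update (N := N) i
  have hH : ContDiff ℝ 1 fun q : Space × Config N => g (Function.update q.2 i q.1) :=
    hg.comp (Lnss.contDiff_update_slot i)
  have hd : Differentiable ℝ fun X : Config N =>
      ∫ y in cell L, g (Function.update X i y) :=
    Literature.Analysis.FunctionSpaces.differentiable_parametric_setIntegral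
      (μ := (volume : Measure Space)) (isBounded_cell L) (measurableSet_cell L) hH one_ne_zero
  have happ := Literature.Analysis.FunctionSpaces.fderiv_parametric_setIntegral_apply
    (μ := (volume : Measure Space)) (isBounded_cell L) (measurableSet_cell L) hH one_ne_zero X V
  unfold cellAvg
  rw [fderiv_fun_const_smul (hd X), FunLike.coe_smul, Pi.smul_apply, happ]
  congr 1
  refine setIntegral_congr_fun (measurableSet_cell L) fun y _ => ?_
  have hgU : HasFDerivAt g (fderiv ℝ g (U (y, X))) (U (y, X)) :=
    ((hg.differentiable one_ne_zero) _).hasFDerivAt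
  have hcomp := hgU.comp (y, X) U.hasFDerivAt
  have hfun : g ∘ ⇑U = fun q : Space × Config N => g (Function.update q.2 i q.1) :=
    funext fun q => by simp only [Function.comp_apply, hU]
  rw [hfun] at hcomp
  rw [hcomp.fderiv, ContinuousLinearMap.comp_apply, hU, hU]

/-- Killing slot `i` of a coordinate direction `e_{j,k}` does not increase a derivative along it:
`‖Dg(Y)(e_{j,k}; ·_i ↦ 0)‖ ≤ ‖Dg(Y) e_{j,k}‖` (equality for `j ≠ i`, zero for `j = i`). [folklore] -/
theorem nnnorm_fderiv_update_single_le (i j : Fin N) (w : Space) (g : Config N → ℂ) (Y : Config N) :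
    ‖fderiv ℝ g Y (Function.update (Pi.single j w : Config N) i 0)‖₊ ≤
      ‖fderiv ℝ g Y (Pi.single j w)‖₊ := by
  by_cases hj : j = i
  · subst hj
    have h0 : Function.update (Pi.single j w : Config N) j 0 = 0 := by
      funext l
      by_cases hl : l = j
      · subst hl; simp
      · simp [hl]
    rw [h0, map_zero, nnnorm_zero]
    exact zero_le
  · have h1 : Function.update (Pi.single j w : Config N) i 0 = Pi.single j w := by
      funext l
      by_cases hl : l = i
      · subst hl; simp [Ne.symm hj]
      · simp [hl]
    rw [h1]

/-- **Jensen for the kinetic density of `P_i g`**: `|∇ P_i g|²(X) ≤ L⁻³ ∫_cell |∇g|²(X; x_i ↦ y) dy`.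
[folklore] -/
theorem kineticDensity_cellAvg_le (hL : 0 < L) (i : Fin N) {g : Config N → ℂ} (hg : ContDiff ℝ 1 g)
    (X : Config N) :
    kineticDensity (cellAvg N L i g) X ≤
      (ENNReal.ofReal (L ^ 3))⁻¹ * ∫⁻ y in cell L, kineticDensity g (Function.update X i y) := by
  have hmeas : ∀ V : Config N, Measurable fun Y : Config N => fderiv ℝ g Y V := fun V =>
    measurable_fderiv_apply_const ℝ g V
  have hterm : ∀ (j : Fin N) (k : Fin 3),
      ((‖fderiv ℝ (cellAvg N L i g) X (Pi.single j (EuclideanSpace.single k (1 : ℝ)))‖₊ : ℝ≥0∞)) ^ 2 ≤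
        (ENNReal.ofReal (L ^ 3))⁻¹ * ∫⁻ y in cell L,
          ((‖fderiv ℝ g (Function.update X i y) (Pi.single j (EuclideanSpace.single k (1 : ℝ)))‖₊ :
            ℝ≥0∞)) ^ 2 := by
    intro j k
    rw [fderiv_cellAvg_apply i hg]
    refine (nnnorm_sq_cellAvg_le hL i (hmeas _) X).trans ?_
    gcongr with y
    exact nnnorm_fderiv_update_single_le i j _ g _
  unfold kineticDensity
  calc ∑ j : Fin N, ∑ k : Fin 3,
        ((‖fderiv ℝ (cellAvg N L i g) X (Pi.single j (EuclideanSpace.single k (1 : ℝ)))‖₊ : ℝ≥0∞)) ^ 2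
      ≤ ∑ j : Fin N, ∑ k : Fin 3, (ENNReal.ofReal (L ^ 3))⁻¹ * ∫⁻ y in cell L,
          ((‖fderiv ℝ g (Function.update X i y) (Pi.single j (EuclideanSpace.single k (1 : ℝ)))‖₊ :
            ℝ≥0∞)) ^ 2 :=
        Finset.sum_le_sum fun j _ => Finset.sum_le_sum fun k _ => hterm j k
    _ = (ENNReal.ofReal (L ^ 3))⁻¹ * ∫⁻ y in cell L, ∑ j : Fin N, ∑ k : Fin 3,
          ((‖fderiv ℝ g (Function.update X i y) (Pi.single j (EuclideanSpace.single k (1 : ℝ)))‖₊ :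
            ℝ≥0∞)) ^ 2 := by
        have hm : ∀ (j : Fin N) (k : Fin 3), Measurable fun y : Space =>
            ((‖fderiv ℝ g (Function.update X i y) (Pi.single j (EuclideanSpace.single k (1 : ℝ)))‖₊ :
              ℝ≥0∞)) ^ 2 := fun j k =>
          (((hmeas (Pi.single j (EuclideanSpace.single k (1 : ℝ)))).comp
            (measurable_update X)).nnnorm.coe_nnreal_ennreal).pow_const 2
        rw [lintegral_finsetSum _ fun j _ => Finset.measurable_sum _ fun k _ => hm j k]
        simp_rw [lintegral_finsetSum _ fun k _ => hm _ k]
        rw [Finset.mul_sum]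
        exact Finset.sum_congr rfl fun j _ => by rw [Finset.mul_sum]

/-- **`∫|∇P_i g|² ≤ ∫|∇g|²`** on `cell^N` (`L > 0`, `g ∈ C¹`). [folklore] -/
theorem lintegral_kineticDensity_cellAvg_le (hL : 0 < L) (i : Fin (n + 1)) {g : Config (n + 1) → ℂ}
    (hg : ContDiff ℝ 1 g) :
    ∫⁻ X in cellN (n + 1) L, kineticDensity (cellAvg (n + 1) L i g) X ≤
      ∫⁻ X in cellN (n + 1) L, kineticDensity g X :=
  calc ∫⁻ X in cellN (n + 1) L, kineticDensity (cellAvg (n + 1) L i g) X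
      ≤ ∫⁻ X in cellN (n + 1) L, (ENNReal.ofReal (L ^ 3))⁻¹ *
          ∫⁻ y in cell L, kineticDensity g (Function.update X i y) :=
        lintegral_mono fun X => kineticDensity_cellAvg_le hL i hg X
    _ = ∫⁻ X in cellN (n + 1) L, kineticDensity g X :=
        lintegral_cellN_slotAvg hL i (measurable_kineticDensity_of_any g)

/-! ## The energy form of `P_i g` -/

/-- The energy form splits into its kinetic and interaction parts. [folklore] -/
theorem eform_eq_add (v : ℝ → ℝ≥0∞) (L : ℝ) (ζ : Config (n + 1) → ℂ) :
    eform v L ζ = (∫⁻ X in cellN (n + 1) L, kineticDensity ζ X) +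
      ∫⁻ X in cellN (n + 1) L, periodicInteraction v L X * ((‖ζ X‖₊ : ℝ≥0∞)) ^ 2 :=
  lintegral_add_left (measurable_kineticDensity_of_any ζ) _

/-- **Energy form of the cell average**: `𝓔(P_i g) ≤ 𝓔(g) + κ‖g‖²` for any
`κ ≥ N² L⁻³ ‖v‖₁`. [folklore] -/
theorem eform_cellAvg_le (hL : 0 < L) {v : ℝ → ℝ≥0∞} (hv : Measurable v) {κ : ℝ≥0∞}
    (hκ : ((n + 1 : ℕ) : ℝ≥0∞) ^ 2 * ((ENNReal.ofReal (L ^ 3))⁻¹ * ∫⁻ x : Space, v ‖x‖) ≤ κ)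
    (i : Fin (n + 1)) {g : Config (n + 1) → ℂ} (hg : ContDiff ℝ 1 g) :
    eform v L (cellAvg (n + 1) L i g) ≤ eform v L g + κ * mass L g := by
  rw [eform_eq_add, eform_eq_add, add_assoc]
  refine add_le_add (lintegral_kineticDensity_cellAvg_le hL i hg) ?_
  refine (lintegral_interaction_sq_cellAvg_le hL hv i hg.continuous).trans (add_le_add le_rfl ?_)
  calc ((n + 1 : ℕ) : ℝ≥0∞) ^ 2 * ((ENNReal.ofReal (L ^ 3))⁻¹ * (∫⁻ x : Space, v ‖x‖) * mass L g)
      = ((n + 1 : ℕ) : ℝ≥0∞) ^ 2 * ((ENNReal.ofReal (L ^ 3))⁻¹ * ∫⁻ x : Space, v ‖x‖) * mass L g := by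
        ring
    _ ≤ κ * mass L g := by gcongr

/-! ## The plane-wave factor `e_p(x_a)` -/

/-- Product and chain rule for `X ↦ e_p(x_a) f(X)`. [folklore] -/
theorem hasFDerivAt_phase_mul (p : Fin 3 → ℤ) (a : Fin N) {f : Config N → ℂ}
    (hf : Differentiable ℝ f) (X : Config N) :
    HasFDerivAt (fun Y : Config N => cellWave L p (Y a) * f Y)
      (cellWave L p (X a) • fderiv ℝ f X +
        f X • (fderiv ℝ (cellWave L p) (X a)).comp (ContinuousLinearMap.proj a)) X := by
  have hw : HasFDerivAt (cellWave L p) (fderiv ℝ (cellWave L p) (X a)) (X a) :=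
    (((contDiff_cellWave L p).differentiable (by simp)) (X a)).hasFDerivAt
  have hπ : HasFDerivAt (fun Y : Config N => Y a) (ContinuousLinearMap.proj a) X :=
    hasFDerivAt_apply (𝕜 := ℝ) a X
  exact (hw.comp X hπ).mul (hf X).hasFDerivAt

/-- The wave number along one axis is at most `2π‖p‖_∞/L`. [folklore] -/
theorem norm_waveCoeff_le (hL : 0 < L) (p : Fin 3 → ℤ) (k : Fin 3) :
    ‖(2 * (Real.pi : ℂ) * Complex.I * ((p k : ℤ) : ℂ) / (L : ℂ))‖ ≤
      2 * Real.pi * ‖(fun j => (p j : ℝ))‖ / L := by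
  have h : ‖(2 * (Real.pi : ℂ) * Complex.I * ((p k : ℤ) : ℂ) / (L : ℂ))‖ =
      2 * Real.pi * |(p k : ℝ)| / L := by
    simp [Complex.norm_real, abs_of_pos Real.pi_pos, abs_of_pos hL]
  rw [h]
  have hk : |(p k : ℝ)| ≤ ‖(fun j => (p j : ℝ))‖ := by
    rw [← Real.norm_eq_abs]
    exact norm_le_pi_norm (fun j => (p j : ℝ)) k
  gcongr

/-- **Kinetic density of `e_p(x_a) f`**: `|∇(e_p(x_a)f)|² ≤ 2|∇f|² + 6N(2π‖p‖/L)²|f|²` pointwise.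
[folklore] -/
theorem kineticDensity_phase_mul_le (hL : 0 < L) (p : Fin 3 → ℤ) (a : Fin N) {f : Config N → ℂ}
    (hf : Differentiable ℝ f) (X : Config N) :
    kineticDensity (fun Y : Config N => cellWave L p (Y a) * f Y) X ≤
      2 * kineticDensity f X +
        2 * ((N : ℝ≥0∞) * (3 * (ENNReal.ofReal ((2 * Real.pi * ‖(fun j => (p j : ℝ))‖ / L) ^ 2) *
          ((‖f X‖₊ : ℝ≥0∞)) ^ 2))) := by
  set K : ℝ≥0∞ := ENNReal.ofReal ((2 * Real.pi * ‖(fun j => (p j : ℝ))‖ / L) ^ 2) with hK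
  have hD := (hasFDerivAt_phase_mul (L := L) p a hf X).fderiv
  -- `|a + b|² ≤ 2|a|² + 2|b|²` (parallelogram law)
  have hpar : ∀ a b : ℂ, ((‖a + b‖₊ : ℝ≥0∞)) ^ 2 ≤
      2 * ((‖a‖₊ : ℝ≥0∞)) ^ 2 + 2 * ((‖b‖₊ : ℝ≥0∞)) ^ 2 := fun a b => by
    have h := ennreal_sq_nnnorm_add_add_sub a b
    rw [mul_add] at h
    exact h ▸ le_self_add
  have hw1 : ‖cellWave L p (X a)‖₊ = 1 := by
    ext; rw [coe_nnnorm, norm_cellWave, NNReal.coe_one]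
  -- the two pieces of each partial derivative
  have hA : ∀ V : Config N, ((‖cellWave L p (X a) * fderiv ℝ f X V‖₊ : ℝ≥0∞)) ^ 2 =
      ((‖fderiv ℝ f X V‖₊ : ℝ≥0∞)) ^ 2 := fun V => by rw [nnnorm_mul, hw1, one_mul]
  have hB : ∀ (j : Fin N) (k : Fin 3),
      ((‖f X * fderiv ℝ (cellWave L p) (X a)
          ((Pi.single j (EuclideanSpace.single k (1 : ℝ)) : Config N) a)‖₊ : ℝ≥0∞)) ^ 2 ≤
        K * ((‖f X‖₊ : ℝ≥0∞)) ^ 2 := by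
    intro j k
    by_cases hja : a = j
    · subst hja
      rw [Pi.single_eq_same, fderiv_cellWave_apply_single, nnnorm_mul, nnnorm_mul, hw1, mul_one,
        ENNReal.coe_mul, mul_pow, mul_comm]
      refine mul_le_mul' ?_ le_rfl
      rw [hK, coe_nnnorm_sq_eq_ofReal (E := ℂ)]
      exact ENNReal.ofReal_le_ofReal
        (pow_le_pow_left₀ (norm_nonneg _) (norm_waveCoeff_le hL p k) 2)
    · rw [Pi.single_eq_of_ne hja, map_zero, mul_zero, nnnorm_zero, ENNReal.coe_zero,
        zero_pow two_ne_zero]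
      exact zero_le
  unfold kineticDensity
  rw [hD]
  simp only [add_apply, FunLike.coe_smul, Pi.smul_apply,
    smul_eq_mul, ContinuousLinearMap.comp_apply, ContinuousLinearMap.proj_apply]
  calc ∑ j : Fin N, ∑ k : Fin 3, ((‖cellWave L p (X a) *
          fderiv ℝ f X (Pi.single j (EuclideanSpace.single k (1 : ℝ))) +
            f X * fderiv ℝ (cellWave L p) (X a)
              ((Pi.single j (EuclideanSpace.single k (1 : ℝ)) : Config N) a)‖₊ : ℝ≥0∞)) ^ 2
      ≤ ∑ j : Fin N, ∑ k : Fin 3,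
          (2 * ((‖fderiv ℝ f X (Pi.single j (EuclideanSpace.single k (1 : ℝ)))‖₊ : ℝ≥0∞)) ^ 2 +
            2 * (K * ((‖f X‖₊ : ℝ≥0∞)) ^ 2)) := by
        refine Finset.sum_le_sum fun j _ => Finset.sum_le_sum fun k _ => ?_
        refine (hpar _ _).trans ?_
        rw [hA]
        gcongr
        exact hB j k
    _ = 2 * ∑ j : Fin N, ∑ k : Fin 3,
          ((‖fderiv ℝ f X (Pi.single j (EuclideanSpace.single k (1 : ℝ)))‖₊ : ℝ≥0∞)) ^ 2 +
          2 * ((N : ℝ≥0∞) * (3 * (K * ((‖f X‖₊ : ℝ≥0∞)) ^ 2))) := by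
        simp only [Finset.sum_add_distrib, Finset.sum_const, Finset.card_univ, Fintype.card_fin,
          nsmul_eq_mul, Finset.mul_sum]
        push_cast
        ring

/-- **`‖e_p(x_a) f‖ = ‖f‖`.** [folklore] -/
theorem mass_phase_mul (p : Fin 3 → ℤ) (a : Fin (n + 1)) (f : Config (n + 1) → ℂ) :
    mass L (fun Y : Config (n + 1) => cellWave L p (Y a) * f Y) = mass L f := by
  unfold mass
  refine lintegral_congr fun X => ?_
  have hw1 : ‖cellWave L p (X a)‖₊ = 1 := by
    ext; rw [coe_nnnorm, norm_cellWave, NNReal.coe_one]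
  rw [nnnorm_mul, hw1, one_mul]

/-- **Energy form of `e_p(x_a) f`**: `𝓔(e_p(x_a)f) ≤ 2𝓔(f) + 6N(2π‖p‖/L)²‖f‖²`. [folklore] -/
theorem eform_phase_mul_le (hL : 0 < L) {v : ℝ → ℝ≥0∞} (hv : Measurable v) (p : Fin 3 → ℤ)
    (a : Fin (n + 1))
    {f : Config (n + 1) → ℂ} (hf : ContDiff ℝ 1 f) :
    eform v L (fun Y : Config (n + 1) => cellWave L p (Y a) * f Y) ≤
      2 * eform v L f +
        2 * (((n + 1 : ℕ) : ℝ≥0∞) * (3 * ENNReal.ofReal ((2 * Real.pi * ‖(fun j => (p j : ℝ))‖ / L) ^ 2))) *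
          mass L f := by
  set K : ℝ≥0∞ := ENNReal.ofReal ((2 * Real.pi * ‖(fun j => (p j : ℝ))‖ / L) ^ 2) with hK
  have hfd : Differentiable ℝ f := hf.differentiable one_ne_zero
  have hfc : Continuous f := hf.continuous
  have hw1 : ∀ X : Config (n + 1), ‖cellWave L p (X a)‖₊ = 1 := fun X => by
    ext; rw [coe_nnnorm, norm_cellWave, NNReal.coe_one]
  have hmk : Measurable fun X => kineticDensity f X := measurable_kineticDensity_of_any f
  have hmm : Measurable fun X : Config (n + 1) => ((‖f X‖₊ : ℝ≥0∞)) ^ 2 :=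
    measurable_nnnorm_sq hfc.measurable
  unfold eform mass
  calc ∫⁻ X in cellN (n + 1) L, kineticDensity (fun Y => cellWave L p (Y a) * f Y) X +
        periodicInteraction v L X * ((‖cellWave L p (X a) * f X‖₊ : ℝ≥0∞)) ^ 2
      ≤ ∫⁻ X in cellN (n + 1) L, 2 * (kineticDensity f X +
          periodicInteraction v L X * ((‖f X‖₊ : ℝ≥0∞)) ^ 2) +
            2 * (((n + 1 : ℕ) : ℝ≥0∞) * (3 * K)) * ((‖f X‖₊ : ℝ≥0∞)) ^ 2 := by
        refine lintegral_mono fun X => ?_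
        rw [nnnorm_mul, hw1, one_mul]
        calc kineticDensity (fun Y => cellWave L p (Y a) * f Y) X +
              periodicInteraction v L X * ((‖f X‖₊ : ℝ≥0∞)) ^ 2
            ≤ (2 * kineticDensity f X + 2 * (((n + 1 : ℕ) : ℝ≥0∞) * (3 * (K * ((‖f X‖₊ : ℝ≥0∞)) ^ 2)))) +
                2 * (periodicInteraction v L X * ((‖f X‖₊ : ℝ≥0∞)) ^ 2) := by
              refine add_le_add ?_ (le_mul_of_one_le_left zero_le one_le_two)
              have h := kineticDensity_phase_mul_le (L := L) hL p a hfd X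
              simpa only [Fintype.card_fin, Nat.cast_add, Nat.cast_one] using h
          _ = _ := by ring
    _ = (2 * ∫⁻ X in cellN (n + 1) L, (kineticDensity f X +
          periodicInteraction v L X * ((‖f X‖₊ : ℝ≥0∞)) ^ 2)) +
            2 * (((n + 1 : ℕ) : ℝ≥0∞) * (3 * K)) *
              ∫⁻ X in cellN (n + 1) L, ((‖f X‖₊ : ℝ≥0∞)) ^ 2 := by
        rw [lintegral_add_left ((measurable_energyIntegrand hv L hfc).const_mul 2),
          lintegral_const_mul _ (measurable_energyIntegrand hv L hfc), lintegral_const_mul _ hmm]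

end Bare

/-- **Part 2 of `stub_bareAdmissible` (registered helper statement)**: the crux's cell average `P_i` does not
increase the kinetic energy on the cell, `∫|∇P_i g|² ≤ ∫|∇g|²` for `C¹` `g` and `L > 0` (`[∇_j, P_i] = 0` for
`j ≠ i`, `∇_i P_i = 0`, Jensen on the cell, Fubini in slot `i`). [folklore] -/
theorem bareAdmissible_kinetic_cellAvg_le :
    ∀ (n : ℕ) (L : ℝ), 0 < L → ∀ (i : Fin (n + 1))
      (g : Literature.MathematicalPhysics.QuantumManyBody.BoseGas.Config (n + 1) → ℂ), ContDiff ℝ 1 g →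
        ∫⁻ X in Literature.MathematicalPhysics.QuantumManyBody.BoseGas.cellN (n + 1) L,
            Literature.MathematicalPhysics.QuantumManyBody.BoseGas.kineticDensity
              (Summit.AtomisticToContinuum.BoseEinsteinCondensation.Theorems.GaussianDominationCan.Negative.cellAvg
                (n + 1) L i g) X ≤
          ∫⁻ X in Literature.MathematicalPhysics.QuantumManyBody.BoseGas.cellN (n + 1) L,
            Literature.MathematicalPhysics.QuantumManyBody.BoseGas.kineticDensity g X :=
  fun _ _ hL i _ hg => Bare.lintegral_kineticDensity_cellAvg_le hL i hg

end Summit.AtomisticToContinuum.BoseEinsteinCondensation.Cruxes.GDTransfer.DysonDressedWitness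

end
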